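import Literature.Analysis.FluidPDE.GigaMiura2011BlowupAnalysis
import Literature.Analysis.FluidPDE.KNSSTypeIRateLiouvilleDescent
import Literature.Analysis.FluidPDE.BoundedWeakIsometry
import Literature.Analysis.FluidPDE.OseenMildUniqueness
import Literature.Analysis.FluidPDE.KNSSOseenMildDecayTools
import Literature.Analysis.FluidPDE.KatoSymmetryCovariance
import Literature.Analysis.FluidPDE.VorticityCalculus
import Literature.Analysis.FluidPDE.VectorCalculusProofs
import HarnessLib

/-!
# Giga–Miura 2011, Proposition 2.2 (core): a time-only vorticity direction forces `ω ≡ 0` —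
# the named fact `gigaMiura2011_unidirectional_vorticity_eq_zero` discharged

Analysis/FluidPDE proof file (everything proved; no definitions, no named facts), sibling of
`GigaMiura2011BlowupAnalysis.lean`, discharging its named fact
`Literature.Analysis.FluidPDE.gigaMiura2011_unidirectional_vorticity_eq_zero` (Y. Giga, H. Miura,
*On vorticity directions near singularities for the Navier–Stokes flows with infinite energy*,
Comm. Math. Phys. **303** (2011) 289–300 = Hokkaido Univ. Preprint **#956**, §2.1, the rigidity
argument on pp. 7–8 of the proof of Proposition 2.2): a bounded backward-global Oseen-mild field
`v` on `ℝ³` with the bounds (2.1), weakly divergence-free slices and a vorticity of the form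
`curl v(t, x) = ‖curl v(t, x)‖ ζ₀(t)` (direction depending on time only) has `curl v ≡ 0`. No
Type I decay is assumed (Proposition 2.2 assumes boundedness only), so the Summits-side special
case `Summit.NavierStokesRegularity.NavierStokesRegularity.Theorems.unidirectionalVorticityLiouville`
(Type-I ancient mild class, conclusion `u ≡ 0`) does not apply; this file gives the decay-free
argument inside `Literature/`.

## The printed argument and how it is followed

Print (HUPS #956 p. 8): "By rotation we may assume that `ω(x,t₀) = (0, 0, ω₃(x,t₀))` … since
`(curl ω)₃ = 0` we have `−Δu₃ = (curl ω)₃ = 0` in `ℝ³`. By the Liouville theorem for harmonic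
functions … `u₃` is spatially constant. Since `0 = ω₁ = ∂u₃/∂x₂ − ∂u₂/∂x₃`,
`0 = ω₂ = ∂u₁/∂x₃ − ∂u₃/∂x₁`, we observe that `u₁` and `u₂` are independent of `x₃`. Thus the
flow is two-dimensional at `t = t₀`. Once the flow is `x₃`-independent and `u₃` is constant, by
the unique local existence theorem of mild solution in [GIM], the solution stays two-dimensional
… for `t ≥ t₀`. One may take `t₀` arbitary so we conclude that `ζ₀` is independent of `t`. …
`u = (u₁, u₂, 0)` and `ω = (0, 0, ω₃)` solves the two-dimensional vorticity equation (2.2).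
However, [Lemma 2.3] … implies that `ω ≡ 0`"; Remark 2.5 (ii): the two-dimensional Liouville
theorem "is already proved in [KNSS]".

The steps are mirrored as follows (coordinate-free, so that "by rotation" is only needed once,
in step 4, where the tree's planar descent is written for the Lean coordinate `1`).

1. *The flow is two-dimensional at each time* — `translationInvariant_of_curl_parallel`: a
   bounded `C²` divergence-free field whose curl is everywhere parallel to a fixed `e ≠ 0` is
   invariant under all translations along `ℝe` (`div curl = 0` makes the coefficient constant
   along `e`; an increment `v(· + he) − v` is bounded, divergence free and irrotational, hence
   constant by the harmonic Liouville theorem `eq_of_curl_eq_zero_of_isDivFree_of_bounded`, hence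
   zero). This is the printed "`u₃` constant, `u₁, u₂` independent of `x₃`" (the constancy of the
   axial component is recovered in step 4).
2. *"[GIM] … the solution stays two-dimensional for `t ≥ t₀`"* —
   `translationInvariant_after_of_oseenMild`: translation invariance of one slice propagates to
   all later slices (translation covariance of the Oseen integral equation,
   `heatExtension_comp_add_right`, `oseenDuhamel_comp_add_right`, and uniqueness of bounded
   Oseen-mild solutions, `oseenMild_bounded_unique` — the tree's form of the uniqueness theorem of
   Giga–Inui–Matsui [GIM] / KNSS 2009 §4).
3. *"`ζ₀` is independent of `t`"* — the printed sentence is imprecise where `ω(·, t₀) ≡ 0`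
   (there `ζ₀(t₀)` carries no information); it is replaced by the stabilisation of the nested
   invariance subspaces `W(t) = {b | v(t, · + hb) = v(t, ·) ∀h}` (non-decreasing in `t` by step 2,
   nonzero by step 1) on a far-past end `t < t₁` (`exists_end_submodule_const`), which yields a
   FIXED nonzero direction `a` of invariance for all `t < 0`.
4. *The two-dimensional Liouville theorem (Lemma 2.3 / "[KNSS]")* — used in the proved form of
   the tree, KNSS 2009 Thm 5.1 (`KNSS2009_liouville_planar_holds`), through the descent of
   bounded weak solutions along an ignorable coordinate
   (`IsBoundedWeakNSSolutionOn.planarTrace_of_lineInvariant`, `planar_const_of_ae_const`) and its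
   transport to an arbitrary axis by a Householder reflection
   (`IsBoundedWeakNSSolutionOn.conj_linearIsometryEquiv`, `Submodule.reflection_sub`):
   `sub_eq_smul_of_boundedWeak_lineInvariant` — the components of `v(t)` orthogonal to `a` are
   spatially constant, i.e. `v(t, x) − v(t, 0) ∈ ℝa`.
5. *Conclusion.* If `W(t₁)` contains a vector off the line `ℝa`, it contains a nonzero `b ⊥ a`,
   step 4 applies along `b` as well and every slice is spatially constant, so `curl v ≡ 0`. If
   `W(t₁) ⊆ ℝa`, then for `t < t₁` a slice with `curl v(t) ≢ 0` would have `ζ₀(t) ∈ W(t) = W(t₁)`,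
   so `ζ₀(t) ∥ a`, while by step 4 `curl v(t) = ∇φ × a ⊥ a`
   (`inner_curl_eq_zero_of_eq_add_smul`) — so `curl v(t) ≡ 0`, `v(t)` is constant and
   `W(t) = ℝ³ ⊄ ℝa`, a contradiction. (This dichotomy is the honest form of the printed
   "`u = (u₁, u₂, 0)`", which silently discards the constant axial drift.)

## Mathlib / tree search

Tree (all proved): `eq_of_curl_eq_zero_of_isDivFree_of_bounded` (`CurlFreeLiouville`),
`divergence_curl_eq_zero_holds` (`VectorCalculusProofs`), `contDiff_curl`, `curl_sub`,
`curl_eq_zero_of_fderiv_eq_zero` (`VorticityCalculus`), `oseenMild_bounded_unique`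
(`OseenMildUniqueness`), `oseenDuhamel_comp_add_right` (`KNSSOseenMildDecayTools`),
`heatExtension_comp_add_right`, `VectorCalculus.IsDivFree.comp_add_right`
(`KatoSymmetryCovariance`), `isBoundedWeakNSSolutionOn_of_oseen`, `planar_const_of_ae_const`
(`KNSSTypeIRateLiouvilleMild`), `IsBoundedWeakNSSolutionOn.planarTrace_of_lineInvariant`
(`KNSSTypeIRateLiouvilleDescent`), `KNSS2009_liouville_planar_holds` (`KNSSLiouvillePlanarHolds`),
`IsBoundedWeakNSSolutionOn.conj_linearIsometryEquiv`, `IsWeaklyDivFree.conj_linearIsometryEquiv`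
(`BoundedWeakIsometry`), `IsWeaklyDivFree.isDivFree_of_contDiff` (`NSBoundedMildOseenClassical`).
The slice lemma, the propagation lemma and the stabilisation lemma are Literature ports of the
Summits-side `stub_sliceInvariantOfCurlParallel`, `stub_translationInvariantAfter`,
`exists_end_submodule_const` (there stated for the Type-I class `IsTypeIAncientMild`, which
Literature cannot import). Mathlib: `Submodule.reflection_sub`, `Submodule.eq_of_le_of_finrank_eq`,
`fderiv_comp_add_right`, `is_const_of_deriv_eq_zero`, `Continuous.ae_eq_iff_eq`.

## References

* Y. Giga, H. Miura, Comm. Math. Phys. 303 (2011) 289–300 = Hokkaido Univ. Preprint #956 (2010),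
  §2.1, Prop. 2.2 and its proof (preprint pp. 7–8). [GigaMiura2011]
* G. Koch, N. Nadirashvili, G. Seregin, V. Šverák, Acta Math. 203 (2009) 83–105 =
  arXiv:0709.3599: Thm 5.1 (p. 9), §4 (ii) (p. 8), §1 p. 3 (symmetries), proof of Thm 6.2
  (p. 13: descent along an ignorable coordinate). [KochNadirashviliSereginSverak2009]
* Y. Giga, K. Inui, S. Matsui, Quad. Mat. 4 (1999) 27–68 ([GIM]: uniqueness of bounded mild
  solutions). [GigaInuiMatsui1999]
-/

noncomputable section

open MeasureTheory Set Function Filter Module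
open scoped RealInnerProductSpace

namespace Literature.Analysis.FluidPDE

/-! ### Step 1: the slice lemma (curl parallel to a fixed vector ⇒ invariance along it) -/

section Slice

/-- **Curl of a translate**: `curl (v(· + a))(x) = (curl v)(x + a)` (the Jacobian of a translate
is the translated Jacobian, Mathlib's `fderiv_comp_add_right`; no differentiability needed).
[folklore] -/
private theorem curl_comp_add_right_aux
    (v : EuclideanSpace ℝ (Fin 3) → EuclideanSpace ℝ (Fin 3)) (a x : EuclideanSpace ℝ (Fin 3)) :
    curl (fun y => v (y + a)) x = curl v (x + a) := by
  -- adapted from `stub_sliceInvariantOfCurlParallel` (Summits, ClockStretchingLaw), itself from `curl_comp_add_const`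
  simp only [curl, fderiv_comp_add_right]

/-- **Divergence of `g e`**: for a scalar `g` differentiable at `x` and a fixed vector `e`,
`div (g e)(x) = Dg(x) e` (the trace of the rank-one map `Dg(x) ⊗ e`). [folklore] -/
private theorem divergence_smul_const_aux {g : EuclideanSpace ℝ (Fin 3) → ℝ}
    {x : EuclideanSpace ℝ (Fin 3)} (hg : DifferentiableAt ℝ g x) (e : EuclideanSpace ℝ (Fin 3)) :
    VectorCalculus.divergence (fun y => g y • e) x = fderiv ℝ g x e := by
  -- adapted from `stub_sliceInvariantOfCurlParallel` (Summits), itself from `divergence_smul_const_eq_fderiv_apply`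
  set b := stdOrthonormalBasis ℝ (EuclideanSpace ℝ (Fin 3)) with hb
  rw [divergence_eq_sum_inner_fderiv b]
  have hD : fderiv ℝ (fun y => g y • e) x = (fderiv ℝ g x).smulRight e :=
    (hg.hasFDerivAt.smul_const e).fderiv
  simp only [hD, ContinuousLinearMap.smulRight_apply, inner_smul_right]
  calc ∑ i, fderiv ℝ g x (b i) * ⟪b i, e⟫ = fderiv ℝ g x (∑ i, ⟪b i, e⟫ • b i) := by
        rw [map_sum]
        refine Finset.sum_congr rfl fun i _ => ?_
        rw [map_smul, smul_eq_mul, mul_comm]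
    _ = fderiv ℝ g x e := by rw [b.sum_repr' e]

/-- **Bounded fields have no constant non-zero increments**: if `‖v‖ ≤ M` and
`v (x + b) - v x = κ` for all `x`, then `κ = 0` (`v (x + n b) - v x = n κ` stays bounded by `2M`;
Archimedes). [folklore] -/
private theorem eq_zero_of_forall_comp_add_sub_eq
    {v : EuclideanSpace ℝ (Fin 3) → EuclideanSpace ℝ (Fin 3)} {M : ℝ} (hM : ∀ x, ‖v x‖ ≤ M)
    {b κ : EuclideanSpace ℝ (Fin 3)} (h : ∀ x, v (x + b) - v x = κ) : κ = 0 := by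
  -- adapted from `stub_sliceInvariantOfCurlParallel` (Summits, ClockStretchingLaw)
  have hiter : ∀ (n : ℕ) (x : EuclideanSpace ℝ (Fin 3)),
      v (x + (n : ℝ) • b) - v x = (n : ℝ) • κ := by
    intro n
    induction n with
    | zero => intro x; simp
    | succ n ih =>
      intro x
      have e1 : x + ((n : ℝ) + 1) • b = x + b + (n : ℝ) • b := by
        rw [add_smul, one_smul]; abel
      simp only [Nat.cast_succ, e1]
      calc v (x + b + (n : ℝ) • b) - v x
          = (v (x + b + (n : ℝ) • b) - v (x + b)) + (v (x + b) - v x) := by abel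
        _ = (n : ℝ) • κ + κ := by rw [ih (x + b), h x]
        _ = ((n : ℝ) + 1) • κ := by rw [add_smul, one_smul]
  have hbd : ∀ n : ℕ, (n : ℝ) * ‖κ‖ ≤ 2 * M := by
    intro n
    have h2 : ‖(n : ℝ) • κ‖ ≤ 2 * M := by
      rw [← hiter n 0]
      exact (norm_sub_le _ _).trans (by linarith [hM (0 + (n : ℝ) • b), hM 0])
    rwa [norm_smul, Real.norm_of_nonneg (Nat.cast_nonneg n)] at h2
  by_contra hκ
  have hκ' : 0 < ‖κ‖ := norm_pos_iff.2 hκ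
  obtain ⟨n, hn⟩ := exists_nat_gt (2 * M / ‖κ‖)
  have h3 := hbd n
  rw [div_lt_iff₀ hκ'] at hn
  linarith

/-- **The slice lemma of Giga–Miura's Proposition 2.2** (HUPS #956 p. 8: "`u₃` is spatially
constant … `u₁` and `u₂` are independent of `x₃`. Thus the flow is two-dimensional"), in the
coordinate-free form: a bounded `C²` divergence-free field `v` on `ℝ³` whose curl is everywhere
parallel to a fixed `e ≠ 0` satisfies `v (x + h e) = v x` for all `x`, `h`. Proof: with
`a = ⟪e, curl v⟫ / ‖e‖²` one has `curl v = a e` and `∂ₑ a = div (a e) = div (curl v) = 0`, so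
`curl v` is invariant along `e`; the increment `v(· + h e) − v` is then bounded, `C²`,
irrotational and divergence free, hence constant (`eq_of_curl_eq_zero_of_isDivFree_of_bounded`,
the harmonic Liouville step of the printed proof), and a bounded field has no non-zero constant
increment. (Literature port of the Summits-side `stub_sliceInvariantOfCurlParallel`.) [cite: GigaMiura2011, Prop. 2.2, proof (§2.1; HUPS preprint #956 p. 8)] -/
theorem translationInvariant_of_curl_parallel
    {v : EuclideanSpace ℝ (Fin 3) → EuclideanSpace ℝ (Fin 3)} (hv : ContDiff ℝ 2 v)
    (hdiv : VectorCalculus.IsDivFree v) (hbdd : ∃ M : ℝ, ∀ x, ‖v x‖ ≤ M)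
    {e : EuclideanSpace ℝ (Fin 3)} (he : e ≠ 0) (hpar : ∀ x, ∃ a : ℝ, curl v x = a • e)
    (x : EuclideanSpace ℝ (Fin 3)) (h : ℝ) : v (x + h • e) = v x := by
  -- adapted from `stub_sliceInvariantOfCurlParallel` (Summits, ClockStretchingLaw)
  obtain ⟨M, hM⟩ := hbdd
  -- `curl v = a • e` with a `C¹` scalar `a`
  have hcurl1 : ContDiff ℝ 1 (curl v) := contDiff_curl (n := 1) (by exact_mod_cast hv)
  have he2 : ‖e‖ ^ 2 ≠ 0 := pow_ne_zero 2 (norm_ne_zero_iff.2 he)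
  obtain ⟨a, ha1, hcurl_eq⟩ : ∃ a : EuclideanSpace ℝ (Fin 3) → ℝ,
      ContDiff ℝ 1 a ∧ ∀ y, curl v y = a y • e := by
    refine ⟨fun y => ⟪e, curl v y⟫ / ‖e‖ ^ 2, (contDiff_const.inner ℝ hcurl1).div_const _,
      fun y => ?_⟩
    obtain ⟨a₀, ha₀⟩ := hpar y
    show curl v y = (⟪e, curl v y⟫ / ‖e‖ ^ 2) • e
    rw [ha₀, real_inner_smul_right, real_inner_self_eq_norm_sq, mul_div_assoc, div_self he2,
      mul_one]
  have hadiff : Differentiable ℝ a := ha1.differentiable one_ne_zero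
  -- `∂ₑ a = div (a e) = div (curl v) = 0`
  have hDa : ∀ y, fderiv ℝ a y e = 0 := by
    intro y
    have h0 : VectorCalculus.divergence (curl v) y = 0 := divergence_curl_eq_zero_holds v hv y
    have hfun : curl v = fun z => a z • e := funext hcurl_eq
    rwa [hfun, divergence_smul_const_aux (hadiff y) e] at h0
  -- `a`, hence `curl v`, is invariant under the translations along `e`
  have ha_inv : ∀ (y : EuclideanSpace ℝ (Fin 3)) (s : ℝ), a (y + s • e) = a y := by
    intro y s
    have hline : ∀ t : ℝ,
        HasDerivAt (fun t : ℝ => a (y + t • e)) (fderiv ℝ a (y + t • e) e) t := by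
      intro t
      have h1 : HasDerivAt (fun t : ℝ => y + t • e) e t := by
        simpa using ((hasDerivAt_id t).smul_const e).const_add y
      exact (hadiff (y + t • e)).hasFDerivAt.comp_hasDerivAt t h1
    have hderiv : ∀ t, deriv (fun t : ℝ => a (y + t • e)) t = 0 := fun t => by
      rw [(hline t).deriv, hDa]
    have hdiff : Differentiable ℝ (fun t : ℝ => a (y + t • e)) := fun t =>
      (hline t).differentiableAt
    simpa using is_const_of_deriv_eq_zero hdiff hderiv s 0
  have hcurl_inv : ∀ (y : EuclideanSpace ℝ (Fin 3)) (s : ℝ), curl v (y + s • e) = curl v y :=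
    fun y s => by rw [hcurl_eq (y + s • e), hcurl_eq y, ha_inv]
  -- the increment `v(· + h e) - v` is `C²`, bounded, curl free and divergence free
  have hvh : ContDiff ℝ 2 (fun y => v (y + h • e)) := hv.comp (contDiff_id.add contDiff_const)
  have hz2 : ContDiff ℝ 2 (fun y => v (y + h • e) - v y) := hvh.sub hv
  have hzcurl : ∀ y, curl (fun y => v (y + h • e) - v y) y = 0 := by
    intro y
    rw [curl_sub (hvh.differentiable two_ne_zero y) (hv.differentiable two_ne_zero y),
      curl_comp_add_right_aux v (h • e) y, hcurl_inv, sub_self]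
  have hzdiv : VectorCalculus.IsDivFree (fun y => v (y + h • e) - v y) := by
    intro y
    have h1 := hdiv (y + h • e)
    have h2 := hdiv y
    simp only [VectorCalculus.divergence] at h1 h2 ⊢
    rw [fderiv_fun_sub (hvh.differentiable two_ne_zero y) (hv.differentiable two_ne_zero y),
      fderiv_comp_add_right]
    simp [map_sub, h1, h2]
  have hzM : ∀ y, ‖v (y + h • e) - v y‖ ≤ 2 * M := fun y =>
    (norm_sub_le _ _).trans (by linarith [hM (y + h • e), hM y])
  -- hence constant (harmonic Liouville for `curl z = 0`, `div z = 0`), and the constant is `0`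
  have hzconst : ∀ y, v (y + h • e) - v y = v (0 + h • e) - v 0 := fun y =>
    eq_of_curl_eq_zero_of_isDivFree_of_bounded hz2 hzcurl hzdiv hzM y 0
  have hc : v (0 + h • e) - v 0 = 0 := eq_zero_of_forall_comp_add_sub_eq hM hzconst
  exact sub_eq_zero.1 ((hzconst x).trans hc)

/-- **The curl of `c + φ a` is orthogonal to `a`**: if `w y = c + φ y • a` for all `y` with `φ`
differentiable at `x`, then `⟪curl w x, a⟫ = 0` (`curl (φ a) = ∇φ × a`). This is the printed
"`0 = ω₁ = ∂u₃/∂x₂ − ∂u₂/∂x₃`, `0 = ω₂ = ∂u₁/∂x₃ − ∂u₃/∂x₁`" read backwards: a flow whose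
components orthogonal to `a` are constant has vorticity orthogonal to `a`. [folklore] -/
private theorem inner_curl_eq_zero_of_eq_add_smul
    {w : EuclideanSpace ℝ (Fin 3) → EuclideanSpace ℝ (Fin 3)} {c a : EuclideanSpace ℝ (Fin 3)}
    {φ : EuclideanSpace ℝ (Fin 3) → ℝ} {x : EuclideanSpace ℝ (Fin 3)} (hφ : DifferentiableAt ℝ φ x)
    (hw : ∀ y, w y = c + φ y • a) : ⟪curl w x, a⟫ = 0 := by
  have hfun : w = fun y => c + φ y • a := funext hw
  have hD : fderiv ℝ w x = (fderiv ℝ φ x).smulRight a := by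
    rw [hfun]
    exact ((hφ.hasFDerivAt.smul_const a).const_add c).fderiv
  simp only [curl, hD, ContinuousLinearMap.smulRight_apply, PiLp.smul_apply, smul_eq_mul,
    PiLp.inner_apply, RCLike.inner_apply, conj_trivial, Fin.sum_univ_three, Matrix.cons_val_zero,
    Matrix.cons_val_one, Matrix.cons_val]
  ring

end Slice

/-! ### Step 2: translation invariance of a slice propagates forward (uniqueness of bounded
Oseen-mild solutions) -/

section Propagation

/-- **Translation invariance of one slice propagates to all later slices** for bounded
backward-global Oseen-mild fields (Giga–Miura: "by the unique local existence theorem of mild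
solution in [GIM], the solution stays two-dimensional … for `t ≥ t₀`"; KNSS 2009, §1 p. 3 and
§4 (4.3)–(4.4)). Let `v : ℝ → ℝ³ → ℝ³` be jointly continuous and bounded on `(−∞, 0) × ℝ³` and
satisfy `v(t) = e^{(t−s)Δ}v(s) − B¹_s(v,v)(t)` for all `s < t < 0`. If `v(s, · + b) = v(s, ·)`
for some `s < 0`, then `v(t, · + b) = v(t, ·)` for all `s < t < 0`: the translate
`w(τ, y) = v(τ, y + b)` is bounded, jointly continuous, and solves the SAME integral equation from
time `s` (`heatExtension_comp_add_right`, `oseenDuhamel_comp_add_right`, and `w(s) = v(s)`), so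
`v(t) = w(t)` a.e. by `oseenMild_bounded_unique`, everywhere by continuity. (Literature port of
the Summits-side `stub_translationInvariantAfter`, there for the Type-I class.) [cite: KochNadirashviliSereginSverak2009, §1 p. 3 and §4 (4.3)–(4.4) (arXiv:0709.3599 p. 8)] -/
theorem translationInvariant_after_of_oseenMild
    {v : ℝ → EuclideanSpace ℝ (Fin 3) → EuclideanSpace ℝ (Fin 3)}
    (hcont : ContinuousOn (uncurry v) (Iio 0 ×ˢ univ))
    (hbdd : ∃ K : ℝ, ∀ t < 0, ∀ x, ‖v t x‖ ≤ K)
    (hmild : ∀ s t : ℝ, s < t → t < 0 → ∀ x,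
      v t x = UnboundedOperators.heatExtension (v s) (t - s) x - oseenDuhamel 1 s v v t x)
    {s : ℝ} (hs : s < 0) {b : EuclideanSpace ℝ (Fin 3)} (hb : ∀ x, v s (x + b) = v s x) :
    ∀ t : ℝ, s < t → t < 0 → ∀ x, v t (x + b) = v t x := by
  -- adapted from `stub_translationInvariantAfter` (Summits, ClockStretchingLaw)
  obtain ⟨K, hK⟩ := hbdd
  intro t hst ht x
  have hK0 : 0 ≤ K := (norm_nonneg _).trans (hK s hs 0)
  -- the translate `w τ y = v τ (y + b)`
  set w : ℝ → EuclideanSpace ℝ (Fin 3) → EuclideanSpace ℝ (Fin 3) := fun τ y => v τ (y + b)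
    with hw
  have hvs : (fun y => v s (y + b)) = v s := funext hb
  have hwcont : ContinuousOn (uncurry w) (Iio 0 ×ˢ univ) := by
    have h1 : ContinuousOn (fun p : ℝ × EuclideanSpace ℝ (Fin 3) => uncurry v (p.1, p.2 + b))
        (Iio 0 ×ˢ univ) :=
      hcont.comp (continuous_fst.prodMk (continuous_snd.add continuous_const)).continuousOn
        fun p hp => ⟨hp.1, mem_univ _⟩
    exact h1
  -- slices are continuous
  have hvc : ∀ τ < 0, Continuous (v τ) := fun τ hτ =>
    hcont.comp_continuous (f := fun y : EuclideanSpace ℝ (Fin 3) => (τ, y)) (by fun_prop)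
      fun y => ⟨hτ, mem_univ _⟩
  have hwc : ∀ τ < 0, Continuous (w τ) := fun τ hτ =>
    hwcont.comp_continuous (f := fun y : EuclideanSpace ℝ (Fin 3) => (τ, y)) (by fun_prop)
      fun y => ⟨hτ, mem_univ _⟩
  -- measurability on the slab `(s, 0) × ℝ³`
  have hsub : Ioo s 0 ×ˢ (univ : Set (EuclideanSpace ℝ (Fin 3))) ⊆ Iio 0 ×ˢ univ :=
    prod_mono (fun τ hτ => hτ.2) subset_rfl
  have hvm : AEStronglyMeasurable (uncurry v)
      ((volume : Measure (ℝ × EuclideanSpace ℝ (Fin 3))).restrict (Ioo s 0 ×ˢ univ)) :=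
    (hcont.mono hsub).aestronglyMeasurable (measurableSet_Ioo.prod MeasurableSet.univ)
  have hwm : AEStronglyMeasurable (uncurry w)
      ((volume : Measure (ℝ × EuclideanSpace ℝ (Fin 3))).restrict (Ioo s 0 ×ˢ univ)) :=
    (hwcont.mono hsub).aestronglyMeasurable (measurableSet_Ioo.prod MeasurableSet.univ)
  have hvM : ∀ τ ∈ Ioo s 0, ∀ y, ‖v τ y‖ ≤ K := fun τ hτ y => hK τ hτ.2 y
  have hwM : ∀ τ ∈ Ioo s 0, ∀ y, ‖w τ y‖ ≤ K := fun τ hτ y => hK τ hτ.2 (y + b)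
  -- the two integral equations with the common free term `e^{(τ-s)Δ} v(s)`
  have hv' : ∀ τ ∈ Ioo s 0, v τ =ᵐ[volume] fun y =>
      UnboundedOperators.heatExtension (v s) (τ - s) y - oseenDuhamel 1 s v v τ y :=
    fun τ hτ => Eventually.of_forall fun y => hmild s τ hτ.1 hτ.2 y
  have hw' : ∀ τ ∈ Ioo s 0, w τ =ᵐ[volume] fun y =>
      UnboundedOperators.heatExtension (v s) (τ - s) y - oseenDuhamel 1 s w w τ y := by
    intro τ hτ
    refine Eventually.of_forall fun y => ?_
    show v τ (y + b) = UnboundedOperators.heatExtension (v s) (τ - s) y -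
      oseenDuhamel 1 s (fun τ y => v τ (y + b)) (fun τ y => v τ (y + b)) τ y
    rw [oseenDuhamel_comp_add_right, hmild s τ hτ.1 hτ.2 (y + b), ← heatExtension_comp_add_right,
      hvs]
  have hae := oseenMild_bounded_unique one_pos hK0 hvm hwm hvM hwM hv' hw' t ⟨hst, ht⟩
  have heq := (Continuous.ae_eq_iff_eq volume (hvc t ht) (hwc t ht)).1 hae
  exact (congr_fun heq x).symm

end Propagation

/-! ### Step 3: nested families of subspaces of `ℝ³` stabilise in the far past -/

/-- **Stabilisation of a nested family of subspaces.** If `W : ℝ → Submodule ℝ ℝ³` is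
non-decreasing along negative times (`W s ≤ W t` for `s < t < 0`), then on some far-past end
`t < t₁ < 0` it is constant: `W t = W t₁` (the dimension is a non-decreasing integer function of
`t`; at a time `t₁` where it attains its minimum over `t < 0` every earlier subspace is contained
in `W t₁` with the same dimension). (Literature port of the Summits-side
`exists_end_submodule_const`.) [folklore] -/
private theorem exists_end_submodule_const_of_mono
    (W : ℝ → Submodule ℝ (EuclideanSpace ℝ (Fin 3)))
    (hmono : ∀ s t : ℝ, s < t → t < 0 → W s ≤ W t) :
    ∃ t₁ < (0 : ℝ), ∀ t < t₁, W t = W t₁ := by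
  -- adapted from `exists_end_submodule_const` (Summits, ClockStretchingLaw)
  classical
  have hP : ∃ n : ℕ, ∃ t < (0 : ℝ), finrank ℝ (W t) = n := ⟨_, -1, by norm_num, rfl⟩
  obtain ⟨t₁, ht₁, hd⟩ := Nat.find_spec hP
  refine ⟨t₁, ht₁, fun t ht => ?_⟩
  have hle : W t ≤ W t₁ := hmono t t₁ ht ht₁
  refine Submodule.eq_of_le_of_finrank_eq hle (le_antisymm (Submodule.finrank_mono hle) ?_)
  rw [hd]
  exact Nat.find_min' hP ⟨t, ht.trans ht₁, rfl⟩

/-! ### Step 4: the planar Liouville theorem along an arbitrary axis of invariance -/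

section Planar

/-- **KNSS Thm 5.1 along the Lean coordinate `1`, decay-free form**: a bounded weak solution
`u` (`ν = 1`) on `ℝ³ × (−∞, 0)`, jointly continuous, with weakly divergence-free slices and
invariant under `x ↦ x + δe₁`, has spatially constant planar components:
`u(t, x)₀ = u(t, 0)₀`, `u(t, x)₂ = u(t, 0)₂` for every `t < 0` and `x` (descent to the plane
`IsBoundedWeakNSSolutionOn.planarTrace_of_lineInvariant`, Thm 5.1
`KNSS2009_liouville_planar_holds`, continuity `planar_const_of_ae_const`; the first two thirds of
the tree's `KNSS2009_typeI_rate_liouville_horizontal_of_weak_planar`, before Remark 6.1 and the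
decay enter). [cite: KochNadirashviliSereginSverak2009, Thm 5.1 (arXiv p. 9) with the descent of the proof of Thm 6.2 (p. 13)] -/
theorem planar_const_of_boundedWeak_lineInvariant
    {u : ℝ → EuclideanSpace ℝ (Fin 3) → EuclideanSpace ℝ (Fin 3)}
    (hu : IsBoundedWeakNSSolutionOn (Iio 0) isOpen_Iio 1 u)
    (hcont : ContinuousOn (uncurry u) (Iio 0 ×ˢ univ))
    (hdiv : ∀ t < 0, IsWeaklyDivFree (u t))
    (hinv : ∀ t < 0, ∀ (x : EuclideanSpace ℝ (Fin 3)) (δ : ℝ),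
      u t (x + EuclideanSpace.single 1 δ) = u t x) :
    ∀ t < 0, ∀ x, u t x 0 = u t 0 0 ∧ u t x 2 = u t 0 2 := by
  have hV := hu.planarTrace_of_lineInvariant hcont (fun t ht => hinv t ht) fun t ht => hdiv t ht
  obtain ⟨b, -, -, hae⟩ := KNSS2009_liouville_planar_holds hV
  exact planar_const_of_ae_const hcont hinv hae

/-- **A vector orthogonal to `a^⊥` lies on the line `ℝa`**: if `a ≠ 0` and `⟪d, w⟫ = 0` for every
`w ⊥ a`, then `d = (⟪d, a⟫/‖a‖²) a`. [folklore] -/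
private theorem eq_smul_of_forall_inner_eq_zero {d a : EuclideanSpace ℝ (Fin 3)} (ha : a ≠ 0)
    (h : ∀ w : EuclideanSpace ℝ (Fin 3), ⟪w, a⟫ = 0 → ⟪d, w⟫ = 0) :
    d = (⟪d, a⟫ / ‖a‖ ^ 2) • a := by
  have ha2 : ‖a‖ ^ 2 ≠ 0 := pow_ne_zero 2 (norm_ne_zero_iff.2 ha)
  set p : EuclideanSpace ℝ (Fin 3) := d - (⟪d, a⟫ / ‖a‖ ^ 2) • a with hp
  have hpa : ⟪p, a⟫ = 0 := by
    rw [hp, inner_sub_left, real_inner_smul_left, real_inner_self_eq_norm_sq,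
      div_mul_cancel₀ _ ha2, sub_self]
  have hdp : ⟪d, p⟫ = 0 := h p hpa
  have hpp : ⟪p, p⟫ = 0 := by
    have e : ⟪p, p⟫ = ⟪d, p⟫ - (⟪d, a⟫ / ‖a‖ ^ 2) * ⟪a, p⟫ := by
      conv_lhs => rw [hp]
      rw [inner_sub_left, real_inner_smul_left]
    rw [e, hdp, real_inner_comm p a, hpa, mul_zero, sub_zero]
  have hp0 : p = 0 := inner_self_eq_zero.1 hpp
  rw [hp] at hp0
  exact (sub_eq_zero.1 hp0)

/-- **KNSS Thm 5.1 along an arbitrary axis, decay-free form**: a bounded weak solution `u`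
(`ν = 1`) on `ℝ³ × (−∞, 0)`, jointly continuous, with weakly divergence-free slices and invariant
under all translations along a line `ℝa` (`a ≠ 0`), has spatially constant components orthogonal
to `a`: `u(t, x) − u(t, 0) = (⟪u(t, x) − u(t, 0), a⟫/‖a‖²) a` for every `t < 0` and `x`. Proof:
conjugate by a Householder reflection `R` with `R a = ‖a‖e₁` (`Submodule.reflection_sub`); the
field `R u(t, R⁻¹ ·)` is again a bounded weak solution
(`IsBoundedWeakNSSolutionOn.conj_linearIsometryEquiv`), jointly continuous, with weakly
divergence-free slices (`IsWeaklyDivFree.conj_linearIsometryEquiv`) and `e₁`-invariant, so its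
components `0, 2` are spatially constant (`planar_const_of_boundedWeak_lineInvariant`); reading
this back through the isometry, `⟪u(t, x) − u(t, 0), w⟫ = 0` for every `w ⊥ a`. (KNSS 2009, §1:
the symmetries of the problem; proof of Thm 6.2, p. 13, for the axis `x₂`.) [cite: KochNadirashviliSereginSverak2009, Thm 5.1 (arXiv p. 9) with the descent of the proof of Thm 6.2 (p. 13)] -/
theorem sub_eq_smul_of_boundedWeak_lineInvariant
    {u : ℝ → EuclideanSpace ℝ (Fin 3) → EuclideanSpace ℝ (Fin 3)}
    (hu : IsBoundedWeakNSSolutionOn (Iio 0) isOpen_Iio 1 u)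
    (hcont : ContinuousOn (uncurry u) (Iio 0 ×ˢ univ))
    (hdiv : ∀ t < 0, IsWeaklyDivFree (u t))
    {a : EuclideanSpace ℝ (Fin 3)} (ha : a ≠ 0)
    (hinv : ∀ t < 0, ∀ (x : EuclideanSpace ℝ (Fin 3)) (s : ℝ), u t (x + s • a) = u t x) :
    ∀ t < 0, ∀ x, u t x - u t 0 = (⟪u t x - u t 0, a⟫ / ‖a‖ ^ 2) • a := by
  -- Householder reflection taking `a` to `‖a‖ e₁`
  have hn : ‖a‖ = ‖(EuclideanSpace.single (1 : Fin 3) ‖a‖ : EuclideanSpace ℝ (Fin 3))‖ := by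
    simp
  obtain ⟨R, hR⟩ : ∃ R : EuclideanSpace ℝ (Fin 3) ≃ₗᵢ[ℝ] EuclideanSpace ℝ (Fin 3),
      R a = EuclideanSpace.single 1 ‖a‖ := ⟨_, Submodule.reflection_sub hn⟩
  have hc : ‖a‖ ≠ 0 := norm_ne_zero_iff.2 ha
  have hpull : ∀ δ : ℝ, R.symm (EuclideanSpace.single 1 δ) = (δ / ‖a‖) • a := by
    -- adapted from `stub_lineLiouvilleEnd` (Summits, SymmetryModuliCount)
    intro δ
    have e1 : R ((δ / ‖a‖) • a) = EuclideanSpace.single (1 : Fin 3) δ := by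
      rw [LinearIsometryEquiv.map_smul, hR]
      ext i
      by_cases hi : i = 1
      · subst hi; simp [div_mul_cancel₀ δ hc]
      · simp [hi]
    rw [← e1, LinearIsometryEquiv.symm_apply_apply]
  -- the conjugate field and its hypotheses
  set U : ℝ → EuclideanSpace ℝ (Fin 3) → EuclideanSpace ℝ (Fin 3) :=
    fun t y => R (u t (R.symm y)) with hU
  have hUw : IsBoundedWeakNSSolutionOn (Iio 0) isOpen_Iio 1 U := hu.conj_linearIsometryEquiv R
  have hUcont : ContinuousOn (uncurry U) (Iio 0 ×ˢ univ) := by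
    have h1 : ContinuousOn
        (fun p : ℝ × EuclideanSpace ℝ (Fin 3) => uncurry u (p.1, R.symm p.2)) (Iio 0 ×ˢ univ) :=
      hcont.comp (continuous_fst.prodMk (R.symm.continuous.comp continuous_snd)).continuousOn
        fun p hp => ⟨hp.1, mem_univ _⟩
    exact R.continuous.comp_continuousOn h1
  have hUdiv : ∀ t < 0, IsWeaklyDivFree (U t) := fun t ht =>
    (hdiv t ht).conj_linearIsometryEquiv R
  have hUinv : ∀ t < 0, ∀ (y : EuclideanSpace ℝ (Fin 3)) (δ : ℝ),
      U t (y + EuclideanSpace.single 1 δ) = U t y := by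
    intro t ht y δ
    show R (u t (R.symm (y + EuclideanSpace.single 1 δ))) = R (u t (R.symm y))
    rw [map_add, hpull δ, hinv t ht (R.symm y) (δ / ‖a‖)]
  have hP := planar_const_of_boundedWeak_lineInvariant hUw hUcont hUdiv hUinv
  -- read off: the increments of `u(t)` are orthogonal to `a^⊥`
  intro t ht x
  refine eq_smul_of_forall_inner_eq_zero ha fun w hw => ?_
  obtain ⟨h0, h2⟩ := hP t ht (R x)
  have hRw1 : (R w) 1 = 0 := by
    have h1 : ⟪R w, R a⟫ = 0 := by rw [LinearIsometryEquiv.inner_map_map, hw]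
    rw [hR, EuclideanSpace.inner_single_right] at h1
    simpa [hc] using h1
  have hx : R (u t x) = U t (R x) := by
    simp only [hU, LinearIsometryEquiv.symm_apply_apply]
  have h0' : R (u t 0) = U t 0 := by
    simp only [hU, map_zero]
  rw [← LinearIsometryEquiv.inner_map_map R, map_sub, hx, h0']
  simp [PiLp.inner_apply, Fin.sum_univ_three, h0, h2, hRw1]

end Planar

/-! ### Step 5: the discharge -/

/-- **Giga–Miura 2011, Proposition 2.2 (core) — the named fact
`gigaMiura2011_unidirectional_vorticity_eq_zero` holds** (HUPS #956 pp. 7–8 = CMP 303 §2.1: a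
bounded backward-global mild solution whose vorticity is `ω(x,t) = |ω(x,t)| ζ₀(t)` with a
direction depending only on `t` has `ω ≡ 0`). Proof (module docstring): slice lemma
(`translationInvariant_of_curl_parallel`), forward propagation of translation invariance
(`translationInvariant_after_of_oseenMild`), far-past stabilisation of the invariance subspaces
(`exists_end_submodule_const_of_mono`) giving a fixed axis `a` of invariance, KNSS Thm 5.1 along
`a` (`sub_eq_smul_of_boundedWeak_lineInvariant`), and the dichotomy: a second invariance direction
off `ℝa` makes every slice constant; otherwise the far-past slices have `curl v ∥ a` and
`curl v ⊥ a` (`inner_curl_eq_zero_of_eq_add_smul`), so they are curl free, hence constant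
(`eq_of_curl_eq_zero_of_isDivFree_of_bounded`), contradicting `W = ℝa`. [cite: GigaMiura2011, Prop. 2.2, proof (§2.1; HUPS preprint #956 pp. 7–8)] -/
theorem gigaMiura2011_unidirectional_vorticity_eq_zero_holds :
    gigaMiura2011_unidirectional_vorticity_eq_zero := by
  intro v hsm hbd hdiv hmild hdir
  obtain ⟨ζ₀, hζ⟩ := hdir
  -- regularity bookkeeping
  have hslice : ∀ t < 0, ContDiff ℝ (⊤ : ℕ∞) (v t) := fun t ht =>
    hsm.comp_contDiff (contDiff_prodMk_right t) fun x => mk_mem_prod (mem_Iio.2 ht) (mem_univ x)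
  have hC2 : ∀ t < 0, ContDiff ℝ 2 (v t) := fun t ht => contDiff_infty.1 (hslice t ht) 2
  have hC1 : ∀ t < 0, ContDiff ℝ 1 (v t) := fun t ht => contDiff_infty.1 (hslice t ht) 1
  have hcont : ContinuousOn (uncurry v) (Iio 0 ×ˢ univ) := hsm.continuousOn
  obtain ⟨K, hK⟩ : ∃ K : ℝ, ∀ t < 0, ∀ x, ‖v t x‖ ≤ K := by
    obtain ⟨C, hC⟩ := hbd 0
    exact ⟨C, fun t ht x => by simpa using hC t ht x⟩
  have hdivF : ∀ t < 0, VectorCalculus.IsDivFree (v t) := fun t ht =>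
    (hdiv t ht).isDivFree_of_contDiff (hC1 t ht)
  have hweak : IsBoundedWeakNSSolutionOn (Iio 0) isOpen_Iio 1 v :=
    isBoundedWeakNSSolutionOn_of_oseen one_pos hcont ⟨K, hK⟩ hdiv fun s t hst ht x => by
      rw [one_mul]; exact hmild s t hst ht x
  -- curl-free slices are constant (harmonic Liouville)
  have hconst_of_curl : ∀ t < 0, (∀ x, curl (v t) x = 0) → ∀ x y, v t x = v t y :=
    fun t ht hc x y => eq_of_curl_eq_zero_of_isDivFree_of_bounded (hC2 t ht) hc (hdivF t ht)
      (hK t ht) x y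
  -- the invariance subspaces `W t = {b | v t (· + h b) = v t}`
  let W : ℝ → Submodule ℝ (EuclideanSpace ℝ (Fin 3)) := fun t =>
    { carrier := {b | ∀ (h : ℝ) (x : EuclideanSpace ℝ (Fin 3)), v t (x + h • b) = v t x}
      add_mem' := fun {a b} ha hb h x => by
        rw [smul_add, ← add_assoc, hb h (x + h • a), ha h x]
      zero_mem' := fun h x => by rw [smul_zero, add_zero]
      smul_mem' := fun c b hb h x => by rw [smul_smul]; exact hb (h * c) x }
  have hmemW : ∀ (t : ℝ) (b : EuclideanSpace ℝ (Fin 3)),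
      b ∈ W t ↔ ∀ (h : ℝ) (x : EuclideanSpace ℝ (Fin 3)), v t (x + h • b) = v t x :=
    fun _ _ => Iff.rfl
  -- nested forward in time (Step 2)
  have hmono : ∀ s t : ℝ, s < t → t < 0 → W s ≤ W t := by
    intro s t hst ht b hb
    rw [hmemW] at hb ⊢
    intro h x
    exact translationInvariant_after_of_oseenMild hcont ⟨K, hK⟩ hmild (hst.trans ht)
      (fun y => hb h y) t hst ht x
  -- curl-free slices have `W t = ⊤`; otherwise `ζ₀ t ≠ 0` lies in `W t` (Step 1)
  have htop_of_curl : ∀ t < 0, (∀ x, curl (v t) x = 0) → W t = ⊤ := fun t ht hc =>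
    eq_top_iff.2 fun b _ => (hmemW t b).2 fun h x => hconst_of_curl t ht hc _ _
  have hslice_inv : ∀ t < 0, (∀ x, curl (v t) x = 0) ∨ (ζ₀ t ≠ 0 ∧ ζ₀ t ∈ W t) := by
    intro t ht
    by_cases hz : ζ₀ t = 0
    · left
      intro x
      rw [hζ t ht x, hz, smul_zero]
    · right
      exact ⟨hz, (hmemW _ _).2 fun h x => translationInvariant_of_curl_parallel (hC2 t ht)
        (hdivF t ht) ⟨K, hK t ht⟩ hz (fun y => ⟨_, hζ t ht y⟩) x h⟩
  have hne : ∀ t < 0, ∃ b ∈ W t, b ≠ 0 := by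
    intro t ht
    rcases hslice_inv t ht with hc | ⟨hz, hmem⟩
    · refine ⟨EuclideanSpace.single 0 1, by rw [htop_of_curl t ht hc]; trivial, ?_⟩
      intro h0
      have := congrArg (fun z : EuclideanSpace ℝ (Fin 3) => z 0) h0
      simp at this
    · exact ⟨ζ₀ t, hmem, hz⟩
  -- stabilisation on a far-past end (Step 3): a fixed axis `a` of invariance for all `t < 0`
  obtain ⟨t₁, ht₁, hstab⟩ := exists_end_submodule_const_of_mono W hmono
  have hWend : ∀ t < 0, W t₁ ≤ W t := by
    intro t ht
    rcases lt_trichotomy t t₁ with h | h | h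
    · rw [hstab t h]
    · rw [h]
    · exact hmono t₁ t h ht
  obtain ⟨a, haW, ha⟩ := hne t₁ ht₁
  have hainv : ∀ t < 0, ∀ (x : EuclideanSpace ℝ (Fin 3)) (s : ℝ), v t (x + s • a) = v t x :=
    fun t ht x s => (hmemW t a).1 (hWend t ht haW) s x
  -- Step 4 along `a`: increments of every slice lie on `ℝa`
  have hline_a := sub_eq_smul_of_boundedWeak_lineInvariant hweak hcont hdiv ha hainv
  have ha2 : ‖a‖ ^ 2 ≠ 0 := pow_ne_zero 2 (norm_ne_zero_iff.2 ha)
  -- Step 5: the dichotomy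
  by_cases hA : ∃ b ∈ W t₁, ∀ μ : ℝ, b ≠ μ • a
  · -- a second invariance direction off the line `ℝa`: all slices are constant
    obtain ⟨b, hbW, hbμ⟩ := hA
    set b' : EuclideanSpace ℝ (Fin 3) := b - (⟪b, a⟫ / ‖a‖ ^ 2) • a with hb'
    have hb'W : b' ∈ W t₁ := (W t₁).sub_mem hbW ((W t₁).smul_mem _ haW)
    have hb'a : ⟪b', a⟫ = 0 := by
      rw [hb', inner_sub_left, real_inner_smul_left, real_inner_self_eq_norm_sq,
        div_mul_cancel₀ _ ha2, sub_self]
    have hb' : b' ≠ 0 := by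
      intro h0
      rw [hb', sub_eq_zero] at h0
      exact hbμ _ h0
    have hbinv : ∀ t < 0, ∀ (x : EuclideanSpace ℝ (Fin 3)) (s : ℝ), v t (x + s • b') = v t x :=
      fun t ht x s => (hmemW t b').1 (hWend t ht hb'W) s x
    have hline_b := sub_eq_smul_of_boundedWeak_lineInvariant hweak hcont hdiv hb' hbinv
    have hconst : ∀ t < 0, ∀ x, v t x = v t 0 := by
      intro t ht x
      have h1 := hline_a t ht x
      have h2 := hline_b t ht x
      have hda : ⟪v t x - v t 0, a⟫ = 0 := by
        rw [h2, real_inner_smul_left, hb'a, mul_zero]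
      rw [hda, zero_div, zero_smul] at h1
      exact sub_eq_zero.1 h1
    intro t ht x
    refine curl_eq_zero_of_fderiv_eq_zero ?_
    have hfun : v t = fun _ => v t 0 := funext (hconst t ht)
    rw [hfun]
    exact (hasFDerivAt_const (v t 0) x).fderiv
  · -- `W t₁ ⊆ ℝa`: impossible
    exfalso
    push Not at hA
    -- far-past slices are curl free
    have hcurl0 : ∀ t < t₁, ∀ x, curl (v t) x = 0 := by
      intro t ht
      have ht0 : t < 0 := ht.trans ht₁
      by_contra hex
      push Not at hex
      obtain ⟨x₀, hx₀⟩ := hex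
      rcases hslice_inv t ht0 with hc | ⟨hz, hmem⟩
      · exact hx₀ (hc x₀)
      · have hmem₁ : ζ₀ t ∈ W t₁ := by rw [← hstab t ht]; exact hmem
        obtain ⟨μ, hμ⟩ := hA _ hmem₁
        -- `curl v(t) ⊥ a` by Step 4, `curl v(t) x₀ = ‖curl v(t) x₀‖ μ a` by hypothesis
        have hφ : DifferentiableAt ℝ (fun y => ⟪v t y - v t 0, a⟫ / ‖a‖ ^ 2) x₀ := by
          have h1 : DifferentiableAt ℝ (fun y => ⟪v t y - v t 0, a⟫ * (‖a‖ ^ 2)⁻¹) x₀ :=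
            ((((hC1 t ht0).differentiable one_ne_zero x₀).sub_const _).inner ℝ
              (differentiableAt_const a)).mul_const _
          simpa only [div_eq_mul_inv] using h1
        have hX : ⟪curl (v t) x₀, a⟫ = 0 :=
          inner_curl_eq_zero_of_eq_add_smul (c := v t 0) hφ fun y => by
            rw [← hline_a t ht0 y]; abel
        rw [hζ t ht0 x₀, hμ, real_inner_smul_left, real_inner_smul_left,
          real_inner_self_eq_norm_sq] at hX
        have hn : ‖curl (v t) x₀‖ ≠ 0 := norm_ne_zero_iff.2 hx₀
        have hμ0 : μ = 0 := by
          rcases mul_eq_zero.1 hX with h | h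
          · exact absurd h hn
          · rcases mul_eq_zero.1 h with h' | h'
            · exact h'
            · exact absurd h' ha2
        exact hz (by rw [hμ, hμ0, zero_smul])
    -- hence `W t₁ = W (t₁ - 1) = ⊤`, which is not contained in the line `ℝa`
    have htop : W t₁ = ⊤ := by
      rw [← hstab (t₁ - 1) (by linarith)]
      exact htop_of_curl _ (by linarith) (hcurl0 _ (by linarith))
    have h0 : (EuclideanSpace.single 0 1 : EuclideanSpace ℝ (Fin 3)) ∈ W t₁ := by
      rw [htop]; trivial
    have h1 : (EuclideanSpace.single 1 1 : EuclideanSpace ℝ (Fin 3)) ∈ W t₁ := by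
      rw [htop]; trivial
    obtain ⟨μ, hμ⟩ := hA _ h0
    obtain ⟨μ', hμ'⟩ := hA _ h1
    have e1 : (1 : ℝ) = μ * a 0 := by
      simpa using congrArg (fun z : EuclideanSpace ℝ (Fin 3) => z 0) hμ
    have e2 : (0 : ℝ) = μ' * a 0 := by
      simpa using congrArg (fun z : EuclideanSpace ℝ (Fin 3) => z 0) hμ'
    have e3 : (1 : ℝ) = μ' * a 1 := by
      simpa using congrArg (fun z : EuclideanSpace ℝ (Fin 3) => z 1) hμ'
    rcases mul_eq_zero.1 e2.symm with h | h
    · rw [h, zero_mul] at e3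
      exact one_ne_zero e3
    · rw [h, mul_zero] at e1
      exact one_ne_zero e1

end Literature.Analysis.FluidPDE

end
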